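import Summits.ResolutionOfSingularities.ResolutionOfSingularities.Theorems.HilbertSamuelEliminationSigmaMaxModificationsCorridor3NearStep
import HarnessLib

/-!
# [OURS · L1 W4.2] THE ISOLATED-STEP CENTRE GERM: at an ISOLATED marked point that is blown up, the canonical centre is,
# near the point, THE POINT (idea-2's finite kernel `Moving.IsoStepCentreGermM`, card G) — PROVED for `ν ≠ Φ^{(N)}`

Stub worker res-L1-w42-stub-3 (gen 3), crux chain w42, line `w_ladder` v5b. `Moving.IsoStepCentreGermM N`
(`…Corridor3WLadderMovingIsoDefs` §3b, p500943; idea-2 ROUND 4 card G «iso-recurrence-core»: «the positive, finite,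
specimen-testable kernel of `IsoTailTowerExtractionM` … NOT implied by any W-row; size M») is ALSO the first step of every
point-sequence / unit bridge at an isolated stage of the W-LOW rows (`stub_Wlow3M_char`, `stub_Wlow3M_two`: third door at
`e ≤ 1`, unit starts `e = ē = 2`; CJS Def. 6.34 (i) / Def. 6.38 (ii) «`X₁ = Bℓ_x(X)`»). This file PROVES it — for every
origin value `ν ≠ Φ^{(N)}` (the regular value is dispatched separately by every row, res-type-066 FINDING 05:18:22Z) — with NO
named fact, from stub-1's near-step dictionary (`IsMaximalOrigin.centre_package`: the canonical centre lies in `X_n(ν)`;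
`IsMaximalOrigin.cycleInv_of_reaches`: `ν` is never exceeded at a reached stage) and the definition of isolation
(`IsIsolatedInHSMaxLocus`: an open `U` with `U ∩ (X_n)_max = {x_n}`):

* `mem_hsMaxLocus_of_mem_hsStratum_of_reaches` — at a stage reached from a maximal origin with `ν ≠ Φ`, every point of the
  `ν`-stratum lies in the Hilbert–Samuel locus `(X_n)_max` (`ν` stays a maximal value);
* `isoStepCentreGerm` — **the germ statement**: `∃ U` open, `x_n ∈ U`, `C.support ∩ U = {x_n}` for the centre `C` of ANY
  canonical step at an isolated reached stage whose centre passes through `x_n`;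
* `isoStepCentreGermM_of_ne_Phi` — the same in the binder order of `Moving.IsoStepCentreGermM N`, under `ν ≠ iterPSum N Phi`;
* `IsBlownUp.isoStepCentreGerm` — the `IsBlownUp` form (functional oracle: THE centre).

OURS bookkeeping over the tree's rendering of CJS Rem. 6.29 (1); NOT a statement of the manuscript [Hironaka2017] nor of
[CossartJannsenSaito2020]; AI-written, weaker than expert review.
References: CJS LNM 2270 Rem. 6.29 (1), Def. 2.35 (`X_max`), Cor. 3.12, Def. 6.34 (i), Def. 6.38 (ii), Def. 13.3
[CossartJannsenSaito2020]; idea-2 card G / Sketch r4 §3b; stub-1's `…Corridor3NearStep` (p5021xx).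
-/

noncomputable section

set_option linter.dupNamespace false -- mandated namespace of this single-conjunct summit

open CategoryTheory AlgebraicGeometry TopologicalSpace Topology
open Literature.AlgebraicGeometry.Resolution Literature.RingTheory.HilbertSamuel
open Literature.AlgebraicGeometry.CossartJannsenSaito2020
open Summit.ResolutionOfSingularities.ResolutionOfSingularities.Theorems.CampaignW42
open Summit.ResolutionOfSingularities.ResolutionOfSingularities.Theorems.SigmaMaxModificationsCorridor3

namespace Summit.ResolutionOfSingularities.ResolutionOfSingularities.Theorems.SigmaMaxModificationsCorridor3.Moving

universe u

variable {p : ℕ} {R : ∀ S : Scheme.{u}, CentreSeq S → Prop} {N : ℕ} {ν : ℕ → ℕ}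

/-- **At a stage reached from a maximal origin (`ν ≠ Φ^{(N)}`), the `ν`-stratum lies in the Hilbert–Samuel locus**: `ν` is
never exceeded by `H^N` at such a stage (cycle invariant), so every point with `H^N = ν` has a maximal value (CJS Cor. 3.12:
a maximal value stays maximal or disappears). [cite: CossartJannsenSaito2020, Cor. 3.12, Def. 2.35] -/
theorem mem_hsMaxLocus_of_mem_hsStratum_of_reaches (hRa : OracleAdmissible R) (hν : ν ≠ iterPSum N Phi)
    {X : Scheme.{u}} [IsLocallyNoetherian X] {x : X} (hX : IsMaximalOrigin p N ν X x) {s : MarkedStage.{u}}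
    (hs : Reaches R N ν (MarkedStage.init X x) s) {y : s.W} (hy : y ∈ Scheme.hsStratum s.W N ν) :
    y ∈ Scheme.hsMaxLocus s.W N := by
  obtain ⟨k, _, _, -, -, -, hsup, -, -⟩ := hX.cycleInv_of_reaches hRa hν hs
  have hyν : Scheme.hsFun s.W N y = ν := Scheme.mem_hsStratum_iff.mp hy
  show Maximal (· ∈ Scheme.hsValues s.W N) (Scheme.hsFun s.W N y)
  rw [hyν]
  refine ⟨⟨y, hyν⟩, fun μ hμ hle => ?_⟩
  obtain ⟨w, rfl⟩ := hμ
  exact (hsup w hle).le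

/-- **THE ISOLATED-STEP CENTRE GERM (PROVED, `ν ≠ Φ^{(N)}`).** At a stage `s` reached from a maximal origin whose marked point
`x_n` is ISOLATED in `(X_n)_max`, the centre `C` of any canonical step from `(s.L, s.P)` passing through `x_n` coincides with
`{x_n}` on an open neighbourhood: `∃ U` open, `x_n ∈ U`, `C.support ∩ U = {x_n}` (the centre lies in `X_n(ν) ⊆ (X_n)_max`,
which meets a neighbourhood of `x_n` only in `x_n`). [cite: CossartJannsenSaito2020, Rem. 6.29 (1), Def. 6.34 (i), Def. 13.3] -/
theorem isoStepCentreGerm (hRa : OracleAdmissible R) (hν : ν ≠ iterPSum N Phi) {X : Scheme.{u}} [IsLocallyNoetherian X]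
    {x : X} (hX : IsMaximalOrigin p N ν X x) {s : MarkedStage.{u}} (hs : Reaches R N ν (MarkedStage.init X x) s)
    (hiso : Iso N s) {C : s.W.IdealSheafData} {P' : Option (Pending (blowup C))} (hst : IsCanonicalStep R N ν s.L s.P C P')
    (hmem : s.pt ∈ (C.support : Set s.W)) :
    ∃ U : Set s.W, IsOpen U ∧ s.pt ∈ U ∧ (C.support : Set s.W) ∩ U = {s.pt} := by
  letI := s.ln
  obtain ⟨U, hU, hUeq⟩ := hiso
  obtain ⟨-, hsub, -, -⟩ := hX.centre_package hRa hν hs hst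
  have hpt : s.pt ∈ U := by
    have h : s.pt ∈ U ∩ Scheme.hsMaxLocus s.W N := by
      rw [hUeq]
      exact Set.mem_singleton s.pt
    exact h.1
  refine ⟨U, hU, hpt, Set.Subset.antisymm ?_ ?_⟩
  · rintro y ⟨hyC, hyU⟩
    have h : y ∈ U ∩ Scheme.hsMaxLocus s.W N :=
      ⟨hyU, mem_hsMaxLocus_of_mem_hsStratum_of_reaches hRa hν hX hs (hsub hyC)⟩
    rwa [hUeq] at h
  · rintro y hy
    rw [Set.mem_singleton_iff] at hy
    subst hy
    exact ⟨hmem, hpt⟩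

/-- **`Moving.IsoStepCentreGermM N` holds at every origin value `ν ≠ Φ^{(N)}`** (binder order of the row; the regular value
`ν = Φ^{(N)}` — where the canonical centre through a marked point can only be the whole (regular) stage — is left to the
consumers' separate dispatch). [cite: CossartJannsenSaito2020, Rem. 6.29 (1), Def. 6.34 (i)] -/
theorem isoStepCentreGermM_of_ne_Phi (R : ∀ S : Scheme.{u}, CentreSeq S → Prop) (_hRf : OracleFunctional R)
    (hRa : OracleAdmissible R) (ν : ℕ → ℕ) (hν : ν ≠ iterPSum N Phi) (X : Scheme.{u}) [IsLocallyNoetherian X] (x : X)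
    (p : ℕ) (hX : IsMaximalOrigin p N ν X x) (s : MarkedStage.{u}) (hs : Reaches R N ν (MarkedStage.init X x) s)
    (hiso : Iso N s) (C : s.W.IdealSheafData) (P' : Option (Pending (blowup C)))
    (hst : IsCanonicalStep R N ν s.L s.P C P') (hmem : s.pt ∈ (C.support : Set s.W)) :
    ∃ U : Set s.W, IsOpen U ∧ s.pt ∈ U ∧ (C.support : Set s.W) ∩ U = {s.pt} :=
  isoStepCentreGerm hRa hν hX hs hiso hst hmem

/-- **`IsBlownUp` form**: at an isolated reached stage whose marked point is blown up, THE centre of every canonical step from it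
is the point near the point (functional oracle: `IsBlownUp.mem_support`). [cite: CossartJannsenSaito2020, Rem. 6.29 (1), Def. 6.38 (ii)] -/
theorem IsBlownUp.isoStepCentreGerm (hRf : OracleFunctional R) (hRa : OracleAdmissible R) (hν : ν ≠ iterPSum N Phi)
    {X : Scheme.{u}} [IsLocallyNoetherian X] {x : X} (hX : IsMaximalOrigin p N ν X x) {s : MarkedStage.{u}}
    (hs : Reaches R N ν (MarkedStage.init X x) s) (hiso : Iso N s) (hb : s.IsBlownUp R N ν)
    {C : s.W.IdealSheafData} {P' : Option (Pending (blowup C))} (hst : IsCanonicalStep R N ν s.L s.P C P') :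
    ∃ U : Set s.W, IsOpen U ∧ s.pt ∈ U ∧ (C.support : Set s.W) ∩ U = {s.pt} :=
  Moving.isoStepCentreGerm hRa hν hX hs hiso hst (hb.mem_support hRf hst)

/-- In-scope form (`Moving.InScopeM`, the origin hidden). [cite: CossartJannsenSaito2020, Rem. 6.29 (1), Def. 6.34 (i)] -/
theorem InScopeM.isoStepCentreGerm (hRa : OracleAdmissible R) (hν : ν ≠ iterPSum N Phi) {s : MarkedStage.{u}}
    (hs : InScopeM p R N ν s) (hiso : Iso N s) {C : s.W.IdealSheafData} {P' : Option (Pending (blowup C))}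
    (hst : IsCanonicalStep R N ν s.L s.P C P') (hmem : s.pt ∈ (C.support : Set s.W)) :
    ∃ U : Set s.W, IsOpen U ∧ s.pt ∈ U ∧ (C.support : Set s.W) ∩ U = {s.pt} := by
  obtain ⟨X, hXln, x, hX, hreach⟩ := hs
  exact Moving.isoStepCentreGerm hRa hν hX hreach hiso hst hmem

end Summit.ResolutionOfSingularities.ResolutionOfSingularities.Theorems.SigmaMaxModificationsCorridor3.Moving

end
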